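import Mathlib
import HarnessLib
import Summits.NavierStokesRegularity.NavierStokesRegularity.Theorems.WakeRatchetMinimalViscousBlowupThresholdContinuity
import Summits.NavierStokesRegularity.NavierStokesRegularity.Theorems.WakeRatchetMinimalViscousBlowupMaximalBlowup

/-!
# Route `WakeRatchet`, crux `MinimalViscousBlowup` (stmt-NavierStokesRegularity-22743), LINE g11-1 «threshold ray» (skeleton v3.10
# ebed8644104749ae), HEART stub α2 `stub_ceilingCriticalWindow` — the critical-window ceiling holds BELOW THE THRESHOLD BLOW-UP TIME

The heart stub α2 asks: at the threshold viscosity `ν` (no global regular solution at `ν`, one at every `ν' > ν`), for EVERY horizon `T₀ > 0`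
there are `δ > 0` and `S₂` with `λⁿ‖X'_n(t)‖² ≤ S₂·ν'²` for all `t ≤ T₀`, all shells `n`, and all global `ν'`-solutions, `ν < ν' < ν + δ`
(a shell-Reynolds ceiling uniform on the critical window).  This file proves the part of α2 that continuity delivers and isolates the rest:
* `ceiling_before_blowup` — along ANY `ν`-trajectory `X` on `[0,T)` from the cascade datum that is (4.5)-regular on every `[0,T']`, `T' < T`
  (binders of the landed `thresholdContinuity`), for every horizon `T₀ < T` there are `δ > 0` and `S₂` such that every global `ν'`-solution with
  `ν < ν' < ν + δ` obeys `λⁿ‖X'_n(t)‖² ≤ S₂·ν'²` on `[0,T₀]`, all `n` — by the landed (E2) `weighted_continuity` (Grönwall in the weight `λ^{8k⁺}`: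
  `X'` stays within `λ^{−8k⁺}` of `X` on `[0,T₀]`, so `λⁿ‖X'_n‖² ≤ 4(M+1)²`, `M` the (4.5) bound of `X` on `[0,T₀]`; `S₂ = 4(M+1)²/ν²`).
* `ceilingCriticalWindow_below_blowupTime` — in α2's own binders: under the threshold hypotheses there is `T⋆ > 0`, the blow-up time of the
  exact `ν`-trajectory from the datum (landed `maximalBlowup`, whose clauses are returned), such that α2's conclusion holds for EVERY horizon
  `T₀ < T⋆`.  So the heart's content is confined to horizons `T₀ ≥ T⋆`: the ceiling on near-threshold global solutions AT AND AFTER the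
  threshold blow-up time (where (E2)'s Grönwall constant degenerates) — the «no-overshoot past T⋆» statement of the line's HEART memo.
MODEL lattice ODEs only (Tao's NS-scaled `ν`-viscous cascade lattice, `m = 4`); nothing here concerns the Navier–Stokes equations; no stub is
closed by name and no summit is proved by this file.  `--supports stmt-NavierStokesRegularity-22743 --as helper`.
[cite: Teschl2012, Thm. 2.8 (dependence on parameters); Tao2016AveragedNS, §4 Lemma 4.1 (4.5)]
-/

noncomputable section

set_option linter.dupNamespace false

open Set Filter Topology

namespace Summit.NavierStokesRegularity.NavierStokesRegularity.Theorems.MinimalViscousBlowup.ThresholdRay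

open Literature.Analysis.FluidPDE Literature.Analysis.FluidPDE.TaoCascade

/-- **The critical-window ceiling before the blow-up time.**  Along a `ν`-trajectory `X` on `[0,T)` from the cascade datum at shell `0`
(no shells below `0`, exact motion law, (4.5)-regular on every `[0,T']`, `T' < T`), for every horizon `0 < T₀ < T` there are `δ > 0` and `S₂`
such that every global regular `ν'`-solution from the same datum with `ν < ν' < ν + δ` satisfies `λⁿ‖X'_n(t)‖² ≤ S₂·ν'²` for all shells `n`
and all `t ∈ [0,T₀]` ((E2) `weighted_continuity` on the window `[0,T₀]`; `S₂ = 4(M+1)²/ν²`).  MODEL lattice only.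
[cite: Teschl2012, Thm. 2.8; Tao2016AveragedNS, §4 Lemma 4.1 (4.5)] -/
theorem ceiling_before_blowup {ε₀ R ν T : ℝ} (hε : 0 < ε₀)
    {α : Fin 4 → Fin 4 → Fin 4 → ℤ × ℤ × ℤ → ℝ} {X₀ : Fin 4 → ℝ} (hα : InTableClass R α) (hν : 0 < ν)
    {X : Fin 4 → ℤ → ℝ → ℝ}
    (hcd : ∀ i n, ContDiffOn ℝ 1 (X i n) (Ico 0 T))
    (hinit : ∀ i n, X i n 0 = if n = 0 then X₀ i else 0)
    (hlow : ∀ i n t, n < 0 → X i n t = 0)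
    (hmot : ∀ i n t, 0 ≤ t → t < T → derivWithin (X i n) (Ici 0) t =
      quadTerm ε₀ α X i n t - ν * (1 + ε₀) ^ ((2 : ℝ) * n) * X i n t)
    (hreg : ∀ T' : ℝ, 0 < T' → T' < T → ∃ M : ℝ, ∀ t : ℝ, 0 ≤ t → t ≤ T' →
      ∀ (i : Fin 4) (n : ℤ), (1 + (1 + ε₀) ^ ((10 : ℝ) * n)) * |X i n t| ≤ M)
    {T₀ : ℝ} (hT₀ : 0 < T₀) (hT₀T : T₀ < T) :
    ∃ δ : ℝ, 0 < δ ∧ ∃ S₂ : ℝ, ∀ ν' : ℝ, ν < ν' → ν' < ν + δ →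
      ∀ X' : Fin 4 → ℤ → ℝ → ℝ, ViscousGlobal ε₀ ν' α X₀ X' →
        ∀ (n : ℤ) (t : ℝ), 0 ≤ t → t ≤ T₀ → (1 + ε₀) ^ n * ‖shellVec X' n t‖ ^ 2 ≤ S₂ * ν' ^ 2 := by
  have hl0 : (0 : ℝ) < 1 + ε₀ := by linarith
  have hl1 : (1 : ℝ) ≤ 1 + ε₀ := by linarith
  -- the (4.5) bound of `X` on the window `[0,T₀]`
  obtain ⟨M₀, hM₀⟩ := hreg T₀ hT₀ hT₀T
  set M : ℝ := max M₀ 0 with hMdef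
  have hM0 : 0 ≤ M := le_max_right _ _
  have hM : ∀ t ∈ Icc (0 : ℝ) T₀, ∀ (i : Fin 4) (k : ℤ), (1 + (1 + ε₀) ^ ((10 : ℝ) * k)) * |X i k t| ≤ M :=
    fun t ht i k => (hM₀ t ht.1 ht.2 i k).trans (le_max_left _ _)
  -- the restricted table is bounded by `1` and drives the same nonlinearity
  have hα' : ∀ i₁ i₂ i₃ μ, |restrictShiftSet α i₁ i₂ i₃ μ| ≤ 1 :=
    abs_restrictShiftSet_le zero_le_one (abs_le_one_of_inTableClass hα)
  -- `X` solves the lattice within the window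
  have hXd : ∀ (i : Fin 4) (k : ℤ), ∀ t ∈ Icc 0 T₀, HasDerivWithinAt (X i k)
      (quadTerm ε₀ (restrictShiftSet α) X i k t - ν * (1 + ε₀) ^ ((2 : ℝ) * k) * X i k t) (Icc 0 T₀) t := by
    intro i k t ht
    have htT : t < T := lt_of_le_of_lt ht.2 hT₀T
    have htI : t ∈ Ico (0 : ℝ) T := ⟨ht.1, htT⟩
    have hd := ((hcd i k).differentiableOn one_ne_zero t htI).hasDerivWithinAt
    have hset : Ico (0 : ℝ) T = Ici 0 ∩ Iio T := Ici_inter_Iio.symm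
    have heq : derivWithin (X i k) (Ico 0 T) t = derivWithin (X i k) (Ici 0) t := by
      rw [hset, derivWithin_inter (Iio_mem_nhds htT)]
    rw [heq, hmot i k t ht.1 htT, ← quadTerm_restrictShiftSet] at hd
    exact hd.mono fun u hu => ⟨hu.1, lt_of_le_of_lt hu.2 hT₀T⟩
  -- Grönwall constant and `δ` for the closeness target `η' = 1`
  set Cg : ℝ := 2 ^ (⌈T₀ * (16 * ((4 : ℕ) : ℝ) ^ 2 * 1 * (1 + ε₀) ^ (10 : ℝ) * (M + 2) + 1)⌉₊ + 1) * M with hCg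
  have hCg0 : 0 ≤ Cg := by rw [hCg]; positivity
  set δ : ℝ := 1 / (Cg + 1) with hδ
  have hδ0 : 0 < δ := by rw [hδ]; positivity
  set B : ℝ := 4 * (M + 1) ^ 2 with hB
  refine ⟨δ, hδ0, B / ν ^ 2, fun ν' hνν' hν'δ X' hX' n t ht0 htT₀ => ?_⟩
  have hν'0 : 0 ≤ ν' := by linarith
  -- `B ≤ (B/ν²)·ν'²`
  have hBle : B ≤ B / ν ^ 2 * ν' ^ 2 := by
    have hB0 : 0 ≤ B := by rw [hB]; positivity
    have hsq : ν ^ 2 ≤ ν' ^ 2 := by nlinarith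
    rw [div_mul_eq_mul_div, le_div_iff₀ (by positivity)]
    exact mul_le_mul_of_nonneg_left hsq hB0
  refine le_trans ?_ hBle
  have hsmall : Cg * |ν' - ν| ≤ 1 := by
    rw [abs_of_pos (by linarith)]
    have h1 : ν' - ν ≤ 1 / (Cg + 1) := by rw [← hδ]; linarith
    calc Cg * (ν' - ν) ≤ Cg * (1 / (Cg + 1)) := mul_le_mul_of_nonneg_left h1 hCg0
      _ = Cg / (Cg + 1) := by ring
      _ ≤ 1 := by rw [div_le_one (by positivity)]; linarith
  -- `X'` solves the lattice within the window
  have hYd : ∀ (i : Fin 4) (k : ℤ), ∀ t ∈ Icc 0 T₀, HasDerivWithinAt (X' i k)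
      (quadTerm ε₀ (restrictShiftSet α) X' i k t - ν' * (1 + ε₀) ^ ((2 : ℝ) * k) * X' i k t) (Icc 0 T₀) t := by
    intro i k t ht
    have h := ((hX'.contDiffOn i k).differentiableOn one_ne_zero t (show t ∈ Ici (0 : ℝ) from ht.1)).hasDerivWithinAt
    rw [hX'.motion i k t ht.1, ← quadTerm_restrictShiftSet] at h
    exact h.mono fun u hu => hu.1
  obtain ⟨M', hM'⟩ := hX'.apriori T₀ hT₀
  -- (E2) on the window, closeness `η' = 1`
  have hD := weighted_continuity (m := 4) (S := T₀) hε zero_le_one hα' hν'0 hM0 one_pos le_rfl le_rfl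
    (fun i k => by rw [hinit, hX'.init]) (fun i k hk t _ => hlow i k t hk) (fun i k hk t ht => hX'.noLow i k t hk ht.1)
    hM ⟨M', fun t ht i k => hM' t ht i k⟩ hXd hYd hsmall
  have htw : t ∈ Icc (0 : ℝ) T₀ := ⟨ht0, htT₀⟩
  rcases lt_or_ge n 0 with hn | hn
  · -- below the datum shell `X'` vanishes
    have h0 : shellVec X' n t = 0 := by
      ext j
      simp [shellVec_apply, hX'.noLow j n t hn ht0]
    rw [h0, norm_zero, hB]
    have : 0 ≤ 4 * (M + 1) ^ 2 := by positivity
    simpa using this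
  · obtain ⟨k, rfl⟩ := Int.eq_ofNat_of_zero_le hn
    rw [zpow_natCast]
    set P : ℝ := (1 + ε₀) ^ k with hP
    have hP0 : 0 < P := pow_pos hl0 k
    have hP1 : 1 ≤ P := one_le_pow₀ hl1
    -- componentwise: `|X| ≤ M/P`, `|X' − X| ≤ 1/P`, so `|X'| ≤ (M+1)/P`
    have hX'k : ∀ i : Fin 4, |X' i k t| ≤ (M + 1) / P := by
      intro i
      have h := hM t htw i k
      have hw : (1 + ε₀) ^ ((10 : ℝ) * ((k : ℕ) : ℤ)) = P ^ 10 := by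
        rw [show ((10 : ℝ) * (((k : ℕ) : ℤ) : ℝ)) = ((k * 10 : ℕ) : ℝ) by push_cast; ring, Real.rpow_natCast, pow_mul]
      rw [hw] at h
      have hP10 : P ≤ P ^ 10 := le_self_pow₀ hP1 (by norm_num)
      have hXk : P * |X i k t| ≤ M := by nlinarith [abs_nonneg (X i k t)]
      have hd := hD t htw i k
      rw [max_eq_left (by positivity : (0 : ℤ) ≤ (k : ℤ))] at hd
      have hw8 : (1 + ε₀) ^ ((8 : ℝ) * (((k : ℕ) : ℤ) : ℝ)) = P ^ 8 := by
        rw [show ((8 : ℝ) * (((k : ℕ) : ℤ) : ℝ)) = ((k * 8 : ℕ) : ℝ) by push_cast; ring, Real.rpow_natCast, pow_mul]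
      rw [hw8] at hd
      have hP8 : P ≤ P ^ 8 := le_self_pow₀ hP1 (by norm_num)
      have hDk : P * |X' i k t - X i k t| ≤ 1 := by nlinarith [abs_nonneg (X' i k t - X i k t)]
      have htri : |X' i k t| ≤ |X i k t| + |X' i k t - X i k t| := by
        have := abs_add_le (X i k t) (X' i k t - X i k t)
        rwa [add_sub_cancel] at this
      rw [le_div_iff₀ hP0]
      nlinarith [abs_nonneg (X i k t), abs_nonneg (X' i k t - X i k t)]
    have hnv : ‖shellVec X' (k : ℤ) t‖ ≤ 2 * ((M + 1) / P) := norm_shellVec_le_two_mul (by positivity) hX'k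
    have hsq : ‖shellVec X' (k : ℤ) t‖ ^ 2 ≤ (2 * ((M + 1) / P)) ^ 2 :=
      pow_le_pow_left₀ (norm_nonneg _) hnv 2
    have h5 : P * (2 * ((M + 1) / P)) ^ 2 = 4 * (M + 1) ^ 2 / P := by
      field_simp
      ring
    have h6 : 4 * (M + 1) ^ 2 / P ≤ 4 * (M + 1) ^ 2 := div_le_self (by positivity) hP1
    calc P * ‖shellVec X' (k : ℤ) t‖ ^ 2 ≤ P * (2 * ((M + 1) / P)) ^ 2 := mul_le_mul_of_nonneg_left hsq hP0.le
      _ = 4 * (M + 1) ^ 2 / P := h5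
      _ ≤ B := by rw [hB]; exact h6

/-- **α2 below the threshold blow-up time (in the stub's binders).**  Under the threshold hypotheses of `stub_ceilingCriticalWindow` (a table
of `E₂(R)`, `ν > 0` carrying NO global regular solution from the datum), there is `T⋆ > 0` — the blow-up time of the exact `ν`-trajectory `X`
from the datum (landed `maximalBlowup`; its clauses are returned: C¹ on `[0,T⋆)`, datum, no shells below `0`, motion law, (4.5)-regular on every
`[0,T']`, weight-10 blow-up at `T⋆`) — such that α2's conclusion holds for EVERY horizon `T₀ < T⋆`: `∃ δ > 0, ∃ S₂`, every global `ν'`-solution,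
`ν < ν' < ν + δ`, has `λⁿ‖X'_n(t)‖² ≤ S₂·ν'²` on `[0,T₀]`.  What α2 asks beyond this is the ceiling for horizons `T₀ ≥ T⋆`.  (The hypotheses
`NoGlobalCascade` and «global solutions above `ν`» of the stub are not needed for this part.)  MODEL lattice only.
[cite: Teschl2012, Thm. 2.8; Tao2016AveragedNS, §4 Lemma 4.1 (4.5)] -/
theorem ceilingCriticalWindow_below_blowupTime : ∀ ε₀ : ℝ, 0 < ε₀ → ∀ R : ℝ, 1 ≤ R →
    ∀ (α : Fin 4 → Fin 4 → Fin 4 → ℤ × ℤ × ℤ → ℝ) (X₀ : Fin 4 → ℝ),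
    Literature.Analysis.FluidPDE.TaoCascade.InTableClass R α →
    ∀ ν : ℝ, 0 < ν →
    (¬ ∃ X : Fin 4 → ℤ → ℝ → ℝ, Literature.Analysis.FluidPDE.TaoCascade.ViscousGlobal ε₀ ν α X₀ X) →
    ∃ (Tstar : ℝ) (X : Fin 4 → ℤ → ℝ → ℝ), 0 < Tstar ∧
      (∀ i n, ContDiffOn ℝ 1 (X i n) (Set.Ico 0 Tstar)) ∧
      (∀ i n, X i n 0 = if n = 0 then X₀ i else 0) ∧
      (∀ i n t, n < 0 → X i n t = 0) ∧
      (∀ i n t, 0 ≤ t → t < Tstar → derivWithin (X i n) (Set.Ici 0) t =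
        Literature.Analysis.FluidPDE.TaoCascade.quadTerm ε₀ α X i n t - ν * (1 + ε₀) ^ ((2 : ℝ) * n) * X i n t) ∧
      (∀ T' : ℝ, 0 < T' → T' < Tstar → ∃ M : ℝ, ∀ t : ℝ, 0 ≤ t → t ≤ T' →
        ∀ (i : Fin 4) (n : ℤ), (1 + (1 + ε₀) ^ ((10 : ℝ) * n)) * |X i n t| ≤ M) ∧
      (∀ M : ℝ, ∃ t : ℝ, 0 ≤ t ∧ t < Tstar ∧
        ∃ (i : Fin 4) (n : ℤ), M < (1 + (1 + ε₀) ^ ((10 : ℝ) * n)) * |X i n t|) ∧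
      ∀ T₀ : ℝ, 0 < T₀ → T₀ < Tstar → ∃ δ : ℝ, 0 < δ ∧ ∃ S₂ : ℝ, ∀ ν' : ℝ, ν < ν' → ν' < ν + δ →
        ∀ X' : Fin 4 → ℤ → ℝ → ℝ, Literature.Analysis.FluidPDE.TaoCascade.ViscousGlobal ε₀ ν' α X₀ X' →
          ∀ (n : ℤ) (t : ℝ), 0 ≤ t → t ≤ T₀ →
            (1 + ε₀) ^ n * ‖Literature.Analysis.FluidPDE.TaoCascade.shellVec X' n t‖ ^ 2 ≤ S₂ * ν' ^ 2 := by
  intro ε₀ hε R hR α X₀ hα ν hν hno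
  obtain ⟨T, X, hT, hcd, hinit, hlow, hmot, hreg, hblow⟩ := maximalBlowup ε₀ hε R hR α X₀ hα ν hν hno
  exact ⟨T, X, hT, hcd, hinit, hlow, hmot, hreg, hblow,
    fun T₀ hT₀ hT₀T => ceiling_before_blowup hε hα hν hcd hinit hlow hmot hreg hT₀ hT₀T⟩

end Summit.NavierStokesRegularity.NavierStokesRegularity.Theorems.MinimalViscousBlowup.ThresholdRay

end
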